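import Mathlib
import Literature.Analysis.Complex.ConeTubeIdentity
import Literature.Analysis.FunctionSpaces.LipschitzDomainCover
import Summits.NavierStokesRegularity.NavierStokesRegularity.Theorems.FilamentSkeletonRssStadiumPartnerPiece

/-!
# Route `FilamentSkeletonRss` · child crux `TangentSkeletonNearStraightL` (stmt-NavierStokesRegularity-23320) · registered line
# `child_tangent_analytic_strip_L` (b0b56c52900dd90a), stub `stub_stripPropagation` — assembly: SCHWARZ REFLECTION OF THE STADIUM-ANALYTIC CURVE

Item R3 (second half) of the quarter-width blueprint (evidence `CORNER-QUARTER-BLUEPRINT-leafhand-15-g0.md` v5 on 23320).  The stadium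
continuation `F` of a real curve is conjugation-symmetric: `Fᵢ(w̄) = conj Fᵢ(w)` on the stadium (`stadium_conj_symm`, identity theorem on
the convex stadium applied to `Fᵢ − conj ∘ Fᵢ ∘ conj`, which vanishes on the real trace).  Consequently the complexified chord square at a
conjugated pair is the conjugate (`chord_sq_conj`), so its REAL PART — the quantity every corner certificate is about — is the same at
`(z̄, ζ̄)` as at `(z, ζ)`.  Together with the holomorphic point reflection `w ↦ 2x₀ − w` of `Theorems.StadiumCornerTransport` (which maps
`(x₀ + a) + iη ↦ (x₀ − a) − iη`) this turns every RIGHT-side certificate (source abscissa `x₀ + a`) into the LEFT-side one (source `x₀ − a`,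
same heights) for the reflected data `F ∘ (2x₀ − ·)` — the left half of the target's contour needs no new estimates.
HONEST FRAMING: bookkeeping for a HYPOTHETICAL filament skeleton on the NEGATIVE side of a MODEL route; the stub `stub_stripPropagation` is NOT
closed by this file; nothing here bears on Navier–Stokes regularity or blow-up.  `--supports stmt-NavierStokesRegularity-23320`.
-/

set_option linter.dupNamespace false

noncomputable section

namespace Summit.NavierStokesRegularity.NavierStokesRegularity.Theorems.StadiumCornerConj

open Set Metric Filter Topology ComplexConjugate
open scoped InnerProductSpace BigOperators
open Summit.NavierStokesRegularity.NavierStokesRegularity.Theorems.StadiumPartnerPiece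

/-- The stadium is convex, hence preconnected. [folklore] -/
theorem stadium_isPreconnected (hs R cc : ℝ) : IsPreconnected {z : ℂ | |z.im| < hs ∧ |z.re - cc| < R} := by
  apply Convex.isPreconnected
  intro z hz w hw a b ha hb hab
  obtain ⟨hz1, hz2⟩ := hz
  obtain ⟨hw1, hw2⟩ := hw
  rw [abs_lt] at hz1 hz2 hw1 hw2
  refine ⟨?_, ?_⟩
  · simp only [Complex.add_im, Complex.smul_im, smul_eq_mul]
    rw [abs_lt]
    constructor
    · have h := Literature.Analysis.FunctionSpaces.convexComb_lt_of_lt ha hb hab (neg_lt_neg hz1.1) (neg_lt_neg hw1.1)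
      linarith
    · exact Literature.Analysis.FunctionSpaces.convexComb_lt_of_lt ha hb hab hz1.2 hw1.2
  · simp only [Complex.add_re, Complex.smul_re, smul_eq_mul]
    rw [abs_lt]
    have e : a * z.re + b * w.re - cc = a * (z.re - cc) + b * (w.re - cc) := by
      have : cc = (a + b) * cc := by rw [hab, one_mul]
      conv_lhs => rw [this]
      ring
    rw [e]
    constructor
    · have h := Literature.Analysis.FunctionSpaces.convexComb_lt_of_lt ha hb hab (neg_lt_neg hz2.1) (neg_lt_neg hw2.1)
      linarith
    · exact Literature.Analysis.FunctionSpaces.convexComb_lt_of_lt ha hb hab hz2.2 hw2.2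

/-- **Schwarz reflection on the stadium.**  `F` holomorphic on `S = {|Im| < hs, |Re − cc| < L + hs}` with real trace `cplx ∘ X`
(`0 < hs`, `0 < L + hs`): `Fᵢ(conj w) = conj (Fᵢ w)` for `w ∈ S`. [folklore] -/
theorem stadium_conj_symm {hs L cc : ℝ} {F : ℂ → (Fin 3 → ℂ)}
    (hF : DifferentiableOn ℂ F {z : ℂ | |z.im| < hs ∧ |z.re - cc| < L + hs})
    {X : ℝ → EuclideanSpace ℝ (Fin 3)}
    (hFX : ∀ r : ℝ, (r : ℂ) ∈ {z : ℂ | |z.im| < hs ∧ |z.re - cc| < L + hs} →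
      F r = fun i => ((⟪X r, EuclideanSpace.single i (1:ℝ)⟫_ℝ : ℝ) : ℂ))
    (hhs : 0 < hs) (hLs : 0 < L + hs) {w : ℂ} (hw : w ∈ {z : ℂ | |z.im| < hs ∧ |z.re - cc| < L + hs}) (i : Fin 3) :
    F (conj w) i = conj (F w i) := by
  set S : Set ℂ := {z : ℂ | |z.im| < hs ∧ |z.re - cc| < L + hs} with hS
  have hSo : IsOpen S := isOpen_stadium hs (L + hs) cc
  have hsymm : ∀ z ∈ S, conj z ∈ S := fun z hz => ⟨by simpa using hz.1, by simpa using hz.2⟩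
  -- the component and its reflection
  set f : ℂ → ℂ := fun z => F z i with hf
  have hfd : DifferentiableOn ℂ f S := fun z hz => by
    have h := (hF z hz)
    exact (differentiableWithinAt_pi.1 h) i
  set g : ℂ → ℂ := fun z => conj (f (conj z)) with hg
  have hgd : DifferentiableOn ℂ g S := Literature.Analysis.Complex.differentiableOn_conj_comp_conj hSo hsymm hfd
  set H : ℂ → ℂ := fun z => f z - g z with hH
  have hHa : AnalyticOnNhd ℂ H S := (hfd.sub hgd).analyticOnNhd hSo
  -- `H` vanishes on the real trace
  have hreal : ∀ r : ℝ, (r : ℂ) ∈ S → H r = 0 := by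
    intro r hr
    have h1 : f r = ((⟪X r, EuclideanSpace.single i (1:ℝ)⟫_ℝ : ℝ) : ℂ) := by
      simp only [hf]; rw [hFX r hr]
    simp only [hH, hg, Complex.conj_ofReal, h1, sub_self]
  -- frequently zero near the real point `cc`
  have hcc : (cc : ℂ) ∈ S := ⟨by simpa using hhs, by simpa using hLs⟩
  have hfreq : ∃ᶠ z in 𝓝[≠] (cc : ℂ), H z = 0 := by
    rw [Filter.frequently_iff]
    intro U hU
    obtain ⟨ε, hε, hεU⟩ := Metric.mem_nhdsWithin_iff.1 hU
    set r : ℝ := min (ε / 2) ((L + hs) / 2) with hr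
    have hr0 : 0 < r := lt_min (by linarith) (by linarith)
    have hrε : r < ε := lt_of_le_of_lt (min_le_left _ _) (by linarith)
    have hrL : r < L + hs := lt_of_le_of_lt (min_le_right _ _) (by linarith)
    refine ⟨((cc + r : ℝ) : ℂ), hεU ⟨?_, ?_⟩, hreal (cc + r) ⟨by simpa using hhs, ?_⟩⟩
    · rw [Metric.mem_ball, Complex.dist_eq]
      have e : ((cc + r : ℝ) : ℂ) - (cc : ℂ) = ((r : ℝ) : ℂ) := by push_cast; ring
      rw [e, Complex.norm_real, Real.norm_eq_abs, abs_of_pos hr0]; exact hrε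
    · simp only [mem_compl_iff, mem_singleton_iff]
      intro h
      have := congrArg Complex.re h
      simp at this
      linarith
    · simp only [Complex.ofReal_re]
      rw [show cc + r - cc = r by ring, abs_of_pos hr0]; exact hrL
  have hzero := hHa.eqOn_zero_of_preconnected_of_frequently_eq_zero (stadium_isPreconnected hs (L + hs) cc) hcc hfreq
  -- conclude at `conj w`
  have h1 : H (conj w) = 0 := hzero (hsymm w hw)
  simp only [hH, hg, hf, Complex.conj_conj, sub_eq_zero] at h1
  exact h1

/-- **The chord square at a conjugated pair is the conjugate.**  Under the hypotheses of `stadium_conj_symm`, for `z, ζ ∈ S`: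
`Σᵢ (Fᵢ(conj ζ) − Fᵢ(conj z))² = conj (Σᵢ (Fᵢ ζ − Fᵢ z)²)`; in particular the real parts agree. [folklore] -/
theorem chord_sq_conj {hs L cc : ℝ} {F : ℂ → (Fin 3 → ℂ)}
    (hF : DifferentiableOn ℂ F {z : ℂ | |z.im| < hs ∧ |z.re - cc| < L + hs})
    {X : ℝ → EuclideanSpace ℝ (Fin 3)}
    (hFX : ∀ r : ℝ, (r : ℂ) ∈ {z : ℂ | |z.im| < hs ∧ |z.re - cc| < L + hs} →
      F r = fun i => ((⟪X r, EuclideanSpace.single i (1:ℝ)⟫_ℝ : ℝ) : ℂ))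
    (hhs : 0 < hs) (hLs : 0 < L + hs) {z ζ : ℂ} (hz : z ∈ {z : ℂ | |z.im| < hs ∧ |z.re - cc| < L + hs})
    (hζ : ζ ∈ {z : ℂ | |z.im| < hs ∧ |z.re - cc| < L + hs}) :
    (∑ i, (F (conj ζ) i - F (conj z) i) ^ 2) = conj (∑ i, (F ζ i - F z i) ^ 2) ∧
    (∑ i, (F (conj ζ) i - F (conj z) i) ^ 2).re = (∑ i, (F ζ i - F z i) ^ 2).re := by
  have h1 : (∑ i, (F (conj ζ) i - F (conj z) i) ^ 2) = conj (∑ i, (F ζ i - F z i) ^ 2) := by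
    rw [map_sum]
    refine Finset.sum_congr rfl fun i _ => ?_
    rw [stadium_conj_symm hF hFX hhs hLs hζ i, stadium_conj_symm hF hFX hhs hLs hz i, map_pow, map_sub]
  exact ⟨h1, by rw [h1, Complex.conj_re]⟩

end Summit.NavierStokesRegularity.NavierStokesRegularity.Theorems.StadiumCornerConj

end
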